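import Literature.Analysis.FluidPDE.TaoEnstrophyLocalisationParts
import Literature.Analysis.FluidPDE.NSViscosityRescaling
import Literature.Analysis.FluidPDE.NSVelocityUniqueness
import HarnessLib

/-!
# Tao (2011/2013), Prop. 9.1, Thm. 10.1 and Cor. 11.1 at unit viscosity (as printed), Cor. 11.4
# (velocity form) at unit viscosity, and the proved rescaling to `ν > 0`

Fourth layer of the decomposition of Tao 2011, Cor. 11.4 (`NS.tao_unconditional_uniqueness`)
along its printed proof. After `TaoEnstrophyLocalisationParts.lean` the `A`-side (Cor. 11.1,
bounded enstrophy) rests on three named facts, each stated for every viscosity `ν > 0` with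
`ν`-dependent constants, their docstrings justifying the passage from Tao's normalisation
`ν = 1` (arXiv:1108.1165, footnote 3, p. 4) by the rescaling `v(s, x) = ν⁻¹u(s/ν, x)`:

* `NS.tao2011_boundedTotalSpeed` (Prop. 9.1, arXiv Prop. 52),
* `NS.tao2011_enstrophyLocalisation_exterior` (Thm. 10.1 in the exterior form of Remark 10.6,
  arXiv Thm. 59 / Rem. 64),
* `NS.tao2011_enstrophyLocalisation_exterior_apriori` (the §10 argument with its two global
  inputs as hypotheses).

This file states the three facts **at unit viscosity, as printed** (`…_unit`), and **proves**
that each unit-viscosity statement is *equivalent* to the `ν > 0` statement of the tree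
(`…_iff_unit`): the direction `ν > 0 ⇒ ν = 1` is specialisation, and `ν = 1 ⇒ ν > 0` is the
rescaling of `NSViscosityRescaling.lean` (`Fluid.IsClassicalNSSolutionOn.viscosityRescale_zero`)
together with the bookkeeping `E ↦ ν⁻²E`, `T ↦ νT`, `δ ↦ ν⁻¹δ`, `ω ↦ ν⁻¹ω`,
`∫₀^{νT}‖v‖_{L^∞} = ∫₀ᵀ‖u‖_{L^∞}`, `∫₀^{νT}∫|∇v|² = ν⁻¹∫₀ᵀ∫|∇u|²`, which produces the constants
`K(ν) = K(ν^{-3/4} + ν⁻²)`, `c(ν) = c/(ν⁻³ + ν⁻⁵)`, `C(ν) = C(ν⁻² + ν^{-3/4} + ν²)` (resp.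
`C(ν⁻² + 1 + ν²)` for the a priori form) and `A(ν) = A(1 + ν^{-1/2})`. So the docstring claims of
the three tree facts about viscosity are now theorems, and the leaves of the Cor. 11.4 / Cor. 11.1
decomposition may be taken to be the printed `ν = 1` statements
(`NS.tao_unconditional_uniqueness_of_unit_leaves`, `NS.tao2011_boundedEnstrophy_of_unit_leaves`).
The `B`-side of Remark 11.3's chain — the composite of Cor. 4.3 and Thm. 5.4 (iii),
`NS.tao2011_velocity_eq_of_memSobolevX` — is **proved** in the tree
(`NS.tao2011_velocity_eq_of_memSobolevX_holds`, `NSVelocityUniqueness.lean`; recorded in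
`NSUnconditionalUniquenessLeaves.lean`), so it is fed in rather than assumed, and no unit form of
it is needed. For completeness the same `ν = 1 ⇔ ν > 0` bookkeeping is done for the remaining
nodes of the `A`-side, all printed for `ν = 1`: Cor. 11.1 itself
(`NS.tao2011_boundedEnstrophy_iff_unit`; `X^k` is preserved by the rescaling,
`NS.memSobolevX_timeRescale`) and Cor. 11.4 in the tree's velocity rendering
(`NS.tao_unconditional_uniqueness_velocity_iff_unit`; that rendering leaves both pressures free,
which is stronger than the printed Cor. 11.4 and is justified by Remark 11.3), whence the vendored
`NS.tao_unconditional_uniqueness` (every `ν > 0`, normalised pressures) follows from the `ν = 1`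
velocity statement (`NS.tao_unconditional_uniqueness_of_velocity_unit`).

## Mathlib / tree search

`lean search 'timeRescale|viscosity|unit'`: no prior unit-viscosity forms of these facts in the
tree; the rescaling itself is `Fluid.IsClassicalNSSolutionOn.viscosityRescale_zero`
(`NSViscosityRescaling.lean`); the `B`-side is the tree theorem
`NS.tao2011_velocity_eq_of_memSobolevX_holds` (`NSVelocityUniqueness.lean`, imported; no cycle). Mathlib used: `eLpNorm_const_smul`, `iteratedFDeriv_const_smul_apply'`,
`fderiv_fun_const_smul`, `MemLp.const_smul`, `Real.rpow_add`, `Real.mul_rpow`,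
`ENNReal.mul_le_mul_iff_right`.

## References

* T. Tao, *Localisation and compactness properties of the Navier–Stokes global regularity
  problem*, Anal. PDE 6 (2013) 25–107 = arXiv:1108.1165 (`Tao2011`): footnote 3 (p. 4) and (31)
  (viscosity and scaling), Prop. 9.1 (arXiv Prop. 52, p. 27), Thm. 10.1, Remarks 10.2 and 10.6
  and the proof of Thm. 10.1 (arXiv Thm. 59, Rem. 60, Rem. 64, pp. 30–33), Lemma 8.1 (arXiv
  Lemma 44), Cor. 11.1 (arXiv Cor. 68), Cor. 11.4 (arXiv Cor. 71).
-/

noncomputable section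

open MeasureTheory Set Function Filter Topology
open scoped ENNReal NNReal ContDiff

namespace Literature.Analysis.FluidPDE

/-- Local notation for physical space `ℝ³ = EuclideanSpace ℝ (Fin 3)`. -/
local notation "ℝ³" => EuclideanSpace ℝ (Fin 3)

/-! ## The three facts at unit viscosity (as printed) -/

/-- **Tao 2011, Prop. 9.1 (Bounded total speed), unit viscosity** (arXiv Prop. 52, p. 27).
Printed: "Let `(u, p, u₀, f, T)` be a finite energy almost smooth solution. Then we have
`‖u‖_{L¹_t L^∞_x([0,T] × ℝ³)} ≲ E(u₀,f,T)^{1/2} T^{1/4} + E(u₀,f,T)`", with an absolute implied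
constant and `E(u₀,f,T) = ½(‖u₀‖_{L²} + ‖f‖_{L¹_t L²_x})²` ((2), p. 3); viscosity `ν = 1` as
throughout the paper. Vendored for `f = 0` (then `E(u₀,0,T) = ½‖u₀‖²_{L²}`, and any
`E ≥ E(u₀,0,T)` may be used since the bound is monotone in `E`), for classical solutions on the
closed slab `[0, T] × ℝ³` (`Fluid.IsClassicalNSSolutionOn (Icc 0 T) 1 0 u p`, a subclass of
Tao's almost smooth solutions) of finite energy ((6): `sup_{t ∈ [0,T]} ∫|u(t)|² < ∞`), with
`‖u(t)‖_{L^∞_x} = eLpNorm (u t) ∞ volume` and the `L¹_t` norm a lower Lebesgue integral over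
`(0, T)`. Equivalent to the tree's `ν > 0` form `tao2011_boundedTotalSpeed`
(`tao2011_boundedTotalSpeed_iff_unit`, proved by rescaling). [cite: Tao2011, Prop. 9.1] -/
def tao2011_boundedTotalSpeed_unit : Prop :=
  ∃ K : ℝ, 0 < K ∧
    ∀ ⦃T : ℝ⦄ (_hT : 0 < T) ⦃u : ℝ → ℝ³ → ℝ³⦄ ⦃p : ℝ → ℝ³ → ℝ⦄
      (_hsol : FluidPDE.IsClassicalNSSolutionOn (Icc 0 T) 1 0 u p)
      (_hfe : ∃ C' : ℝ≥0, ∀ t ∈ Icc 0 T, ∫⁻ x, ‖u t x‖ₑ ^ 2 ≤ C')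
      ⦃E : ℝ⦄ (_hE : 0 ≤ E) (_hE₀ : ∫⁻ x, ‖u 0 x‖ₑ ^ 2 ≤ ENNReal.ofReal (2 * E)),
      ∫⁻ t in Ioo 0 T, eLpNorm (u t) ∞ volume ≤
        ENNReal.ofReal (K * (Real.sqrt E * T ^ (1 / 4 : ℝ) + E))

/-- **Tao 2011, Thm. 10.1 (Enstrophy localisation) in the exterior form of Remark 10.6, unit
viscosity** (arXiv Thm. 59, p. 30, and Rem. 64, p. 33), homogeneous case `f = 0`. Printed
(`ν = 1`): for a finite energy almost smooth solution with `‖ω₀‖_{L²} ≤ δ` on the region (10.1),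
`δ⁴T + δ⁵E(u₀,f,T)^{1/2}T ≤ c` (10.2) and `R/2 > r > C(E(u₀,f,T) + E(u₀,f,T)^{1/2}T^{1/4} + δ⁻²)`
(10.3), `c` small and `C` large absolute constants, one has
`‖ω‖_{L^∞_t L²_x} + ‖∇ω‖_{L²_t L²_x} ≲ δ` on `[0, T] ×` the shrunken region; Remark 10.6: the
region may be the exterior `ℝ³ ∖ B(x₀, R)`, shrunken to `ℝ³ ∖ B(x₀, R + r)`. Dictionary exactly as
in the tree's `ν > 0` form `tao2011_enstrophyLocalisation_exterior` (classical solution on the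
closed slab; any `E ≥ ½‖u(0)‖²_{L²}`; `ω = Fluid.curl`, `|∇ω|` the operator norm of `D(curl u)`;
`L^∞_t` pointwise in `t`; the two summands bounded separately by `Aδ`), to which it is
equivalent (`tao2011_enstrophyLocalisation_exterior_iff_unit`, proved by rescaling). [cite: Tao2011, Thm. 10.1 + Remark 10.6] -/
def tao2011_enstrophyLocalisation_exterior_unit : Prop :=
  ∃ c C A : ℝ, 0 < c ∧ 0 < C ∧ 0 < A ∧
    ∀ ⦃T : ℝ⦄ (_hT : 0 < T) ⦃u : ℝ → ℝ³ → ℝ³⦄ ⦃p : ℝ → ℝ³ → ℝ⦄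
      (_hsol : FluidPDE.IsClassicalNSSolutionOn (Icc 0 T) 1 0 u p)
      (_hfe : ∃ C' : ℝ≥0, ∀ t ∈ Icc 0 T, ∫⁻ x, ‖u t x‖ₑ ^ 2 ≤ C')
      ⦃E : ℝ⦄ (_hE : 0 ≤ E) (_hE₀ : ∫⁻ x, ‖u 0 x‖ₑ ^ 2 ≤ ENNReal.ofReal (2 * E))
      (x₀ : ℝ³) ⦃R r δ : ℝ⦄ (_hδ : 0 < δ) (_hr : 0 < r) (_hrR : r < R / 2)
      (_hω₀ : ∫⁻ x in (Metric.ball x₀ R)ᶜ, ‖FluidPDE.curl (u 0) x‖ₑ ^ 2 ≤ ENNReal.ofReal (δ ^ 2))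
      (_hsmall : δ ^ 4 * T + δ ^ 5 * Real.sqrt E * T ≤ c)
      (_hlarge : C * (E + Real.sqrt E * T ^ (1 / 4 : ℝ) + δ⁻¹ ^ 2) < r),
      (∀ t ∈ Icc 0 T, ∫⁻ x in (Metric.ball x₀ (R + r))ᶜ, ‖FluidPDE.curl (u t) x‖ₑ ^ 2 ≤
          ENNReal.ofReal ((A * δ) ^ 2)) ∧
        ∫⁻ t in Ioo 0 T, ∫⁻ x in (Metric.ball x₀ (R + r))ᶜ,
            ‖fderiv ℝ (FluidPDE.curl (u t)) x‖ₑ ^ 2 ≤ ENNReal.ofReal ((A * δ) ^ 2)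

/-- **Tao 2011, Thm. 10.1 (exterior form), a priori form, unit viscosity** — the statement the
printed proof of Thm. 10.1 (§10, arXiv pp. 30–33, `ν = 1`) establishes once its two global
inputs, Prop. 9.1 (`∫₀ᵀ‖u‖_{L^∞} ≤ M`, used for `R'(t) ≥ R − r/2`) and Lemma 8.1
(`sup_t ½∫|u|² ≤ E`, `∫₀ᵀ∫|∇u|² ≤ E`, used for `Y_{6,2}` and the pigeonhole choice of `R'`), are
made hypotheses and (10.3) is read as `r > C(E + M + δ⁻²)`; see
`tao2011_enstrophyLocalisation_exterior_apriori` (the tree's `ν > 0` form, same dictionary), to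
which it is equivalent (`tao2011_enstrophyLocalisation_exterior_apriori_iff_unit`, proved by
rescaling). Like that form it is implied by the printed theorem at `ν = 1`
(`tao2011_enstrophyLocalisation_exterior_apriori_unit_of_exterior_unit`). The dissipation
hypothesis `_hD` deliberately carries the factor `ENNReal.ofReal 1 * …` (not a typo): it keeps this
statement definitionally equal to the `ν := 1` instance of the `ν > 0` form, so that the
specialisation `tao2011_enstrophyLocalisation_exterior_apriori_unit_of` is `h one_pos`. [cite: Tao2011, Thm. 10.1 (proof, §10) + Remark 10.6] -/
def tao2011_enstrophyLocalisation_exterior_apriori_unit : Prop :=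
  ∃ c C A : ℝ, 0 < c ∧ 0 < C ∧ 0 < A ∧
    ∀ ⦃T : ℝ⦄ (_hT : 0 < T) ⦃u : ℝ → ℝ³ → ℝ³⦄ ⦃p : ℝ → ℝ³ → ℝ⦄
      (_hsol : FluidPDE.IsClassicalNSSolutionOn (Icc 0 T) 1 0 u p)
      ⦃E M : ℝ⦄ (_hE : 0 ≤ E) (_hM : 0 ≤ M)
      (_hEt : ∀ t ∈ Icc 0 T, ∫⁻ x, ‖u t x‖ₑ ^ 2 ≤ ENNReal.ofReal (2 * E))
      (_hD : ENNReal.ofReal 1 *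
          ∫⁻ t in Ioo 0 T, ∫⁻ x, ENNReal.ofReal (FluidPDE.frobeniusNormSq (fderiv ℝ (u t) x)) ≤
        ENNReal.ofReal E)
      (_hMt : ∫⁻ t in Ioo 0 T, eLpNorm (u t) ∞ volume ≤ ENNReal.ofReal M)
      (x₀ : ℝ³) ⦃R r δ : ℝ⦄ (_hδ : 0 < δ) (_hr : 0 < r) (_hrR : r < R / 2)
      (_hω₀ : ∫⁻ x in (Metric.ball x₀ R)ᶜ, ‖FluidPDE.curl (u 0) x‖ₑ ^ 2 ≤ ENNReal.ofReal (δ ^ 2))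
      (_hsmall : δ ^ 4 * T + δ ^ 5 * Real.sqrt E * T ≤ c)
      (_hlarge : C * (E + M + δ⁻¹ ^ 2) < r),
      (∀ t ∈ Icc 0 T, ∫⁻ x in (Metric.ball x₀ (R + r))ᶜ, ‖FluidPDE.curl (u t) x‖ₑ ^ 2 ≤
          ENNReal.ofReal ((A * δ) ^ 2)) ∧
        ∫⁻ t in Ioo 0 T, ∫⁻ x in (Metric.ball x₀ (R + r))ᶜ,
            ‖fderiv ℝ (FluidPDE.curl (u t)) x‖ₑ ^ 2 ≤ ENNReal.ofReal ((A * δ) ^ 2)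

/-! ## Specialisation `ν > 0 ⇒ ν = 1` -/

/-- The `ν > 0` form of Prop. 9.1 specialises to the unit-viscosity form. [cite: Tao2011, Prop. 9.1] -/
theorem tao2011_boundedTotalSpeed_unit_of (h : tao2011_boundedTotalSpeed) :
    tao2011_boundedTotalSpeed_unit := h one_pos

/-- The `ν > 0` form of Thm. 10.1 (exterior) specialises to the unit-viscosity form. [cite: Tao2011, Thm. 10.1 + Remark 10.6] -/
theorem tao2011_enstrophyLocalisation_exterior_unit_of (h : tao2011_enstrophyLocalisation_exterior) :
    tao2011_enstrophyLocalisation_exterior_unit := h one_pos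

/-- The `ν > 0` a priori form specialises to the unit-viscosity a priori form. [cite: Tao2011, Thm. 10.1 (proof, §10) + Remark 10.6] -/
theorem tao2011_enstrophyLocalisation_exterior_apriori_unit_of
    (h : tao2011_enstrophyLocalisation_exterior_apriori) :
    tao2011_enstrophyLocalisation_exterior_apriori_unit := h one_pos

/-! ## Bookkeeping for the rescaled solution `v(s, x) = ν⁻¹u(s/ν, x)` -/

section Bookkeeping

variable {ν : ℝ}

/-- `‖ν⁻¹‖ₑ · ν = 1` in `ℝ≥0∞` for `ν > 0`. [folklore] -/
theorem enorm_inv_mul_ofReal (hν : 0 < ν) : ‖ν⁻¹‖ₑ * ENNReal.ofReal ν = 1 := by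
  rw [Real.enorm_eq_ofReal_abs, abs_of_pos (inv_pos.2 hν), ← ENNReal.ofReal_mul (inv_pos.2 hν).le,
    inv_mul_cancel₀ hν.ne', ENNReal.ofReal_one]

/-- `ν⁻² · ν = ν⁻¹` in `ℝ≥0∞` for `ν > 0`. [folklore] -/
theorem ofReal_inv_sq_mul_ofReal (hν : 0 < ν) :
    ENNReal.ofReal (ν⁻¹ ^ 2) * ENNReal.ofReal ν = ENNReal.ofReal ν⁻¹ := by
  rw [← ENNReal.ofReal_mul (by positivity), sq, mul_assoc, inv_mul_cancel₀ hν.ne', mul_one]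

/-- Energy of a slice of the rescaled velocity: `∫|v(s)|² = ν⁻² ∫|u(s/ν)|²`. [folklore] -/
theorem lintegral_timeRescale_sq (ν : ℝ) (u : ℝ → ℝ³ → ℝ³) (s : ℝ) :
    ∫⁻ x, ‖FluidPDE.timeRescale ν⁻¹ ν⁻¹ u s x‖ₑ ^ 2 =
      ENNReal.ofReal (ν⁻¹ ^ 2) * ∫⁻ x, ‖u (ν⁻¹ * s) x‖ₑ ^ 2 := by
  rw [FluidPDE.timeRescale_slice]
  exact FluidPDE.lintegral_enorm_sq_const_smul _ _ _

/-- `L^∞` norm of a slice of the rescaled velocity: `‖v(s)‖_{L^∞} = ν⁻¹‖u(s/ν)‖_{L^∞}`. [folklore] -/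
theorem eLpNorm_timeRescale (ν : ℝ) (u : ℝ → ℝ³ → ℝ³) (s : ℝ) :
    eLpNorm (FluidPDE.timeRescale ν⁻¹ ν⁻¹ u s) ∞ volume = ‖ν⁻¹‖ₑ * eLpNorm (u (ν⁻¹ * s)) ∞ volume := by
  rw [FluidPDE.timeRescale_slice]
  exact eLpNorm_const_smul ν⁻¹ (u (ν⁻¹ * s)) ∞ volume

/-- Total speed is invariant: `∫₀^{νT} ‖v(s)‖_{L^∞} ds = ∫₀ᵀ ‖u(t)‖_{L^∞} dt`. [cite: Tao2011, footnote 3] -/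
theorem setLIntegral_eLpNorm_timeRescale (hν : 0 < ν) (u : ℝ → ℝ³ → ℝ³) (T : ℝ) :
    ∫⁻ s in Ioo 0 (ν * T), eLpNorm (FluidPDE.timeRescale ν⁻¹ ν⁻¹ u s) ∞ volume =
      ∫⁻ t in Ioo 0 T, eLpNorm (u t) ∞ volume := by
  simp_rw [eLpNorm_timeRescale]
  rw [lintegral_const_mul' _ _ (by simp),
    FluidPDE.setLIntegral_Ioo_comp_inv_mul (fun t => eLpNorm (u t) ∞ volume) hν T, ← mul_assoc,
    enorm_inv_mul_ofReal hν, one_mul]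

/-- Finite energy is preserved by the rescaling. [folklore] -/
theorem finiteEnergy_timeRescale (hν : 0 < ν) {T : ℝ} {u : ℝ → ℝ³ → ℝ³}
    (hfe : ∃ C' : ℝ≥0, ∀ t ∈ Icc 0 T, ∫⁻ x, ‖u t x‖ₑ ^ 2 ≤ C') :
    ∃ C' : ℝ≥0, ∀ s ∈ Icc 0 (ν * T), ∫⁻ x, ‖FluidPDE.timeRescale ν⁻¹ ν⁻¹ u s x‖ₑ ^ 2 ≤ C' := by
  obtain ⟨C', hC'⟩ := hfe
  refine ⟨Real.toNNReal (ν⁻¹ ^ 2) * C', fun s hs => ?_⟩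
  rw [lintegral_timeRescale_sq, ENNReal.coe_mul]
  exact mul_le_mul_right (hC' _ (FluidPDE.mapsTo_inv_mul_Icc hν hs)) _

/-- The energy hypothesis `∫|u(t)|² ≤ 2E` on `[0, T]` becomes `∫|v(s)|² ≤ 2ν⁻²E` on `[0, νT]`. [folklore] -/
theorem energy_timeRescale_le (hν : 0 < ν) {T E : ℝ} {u : ℝ → ℝ³ → ℝ³}
    (hEt : ∀ t ∈ Icc 0 T, ∫⁻ x, ‖u t x‖ₑ ^ 2 ≤ ENNReal.ofReal (2 * E)) :
    ∀ s ∈ Icc 0 (ν * T), ∫⁻ x, ‖FluidPDE.timeRescale ν⁻¹ ν⁻¹ u s x‖ₑ ^ 2 ≤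
      ENNReal.ofReal (2 * (ν⁻¹ ^ 2 * E)) := by
  intro s hs
  rw [lintegral_timeRescale_sq, show 2 * (ν⁻¹ ^ 2 * E) = ν⁻¹ ^ 2 * (2 * E) by ring,
    ENNReal.ofReal_mul (sq_nonneg _)]
  exact mul_le_mul_right (hEt _ (FluidPDE.mapsTo_inv_mul_Icc hν hs)) _

/-- The initial energy hypothesis `∫|u(0)|² ≤ 2E` becomes `∫|v(0)|² ≤ 2ν⁻²E`. [folklore] -/
theorem energy_zero_timeRescale_le (ν : ℝ) {E : ℝ} {u : ℝ → ℝ³ → ℝ³}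
    (hE₀ : ∫⁻ x, ‖u 0 x‖ₑ ^ 2 ≤ ENNReal.ofReal (2 * E)) :
    ∫⁻ x, ‖FluidPDE.timeRescale ν⁻¹ ν⁻¹ u 0 x‖ₑ ^ 2 ≤ ENNReal.ofReal (2 * (ν⁻¹ ^ 2 * E)) := by
  rw [lintegral_timeRescale_sq, mul_zero, show 2 * (ν⁻¹ ^ 2 * E) = ν⁻¹ ^ 2 * (2 * E) by ring,
    ENNReal.ofReal_mul (sq_nonneg _)]
  exact mul_le_mul_right hE₀ _

/-- Vorticity of a slice of the rescaled velocity of a classical solution: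
`curl v(s) = ν⁻¹ curl u(s/ν)`. [folklore] -/
theorem curl_timeRescale {T : ℝ} {u : ℝ → ℝ³ → ℝ³} {p : ℝ → ℝ³ → ℝ}
    (hsol : FluidPDE.IsClassicalNSSolutionOn (Icc 0 T) ν 0 u p) (hν : 0 < ν) {s : ℝ}
    (hs : s ∈ Icc 0 (ν * T)) :
    FluidPDE.curl (FluidPDE.timeRescale ν⁻¹ ν⁻¹ u s) = fun x => ν⁻¹ • FluidPDE.curl (u (ν⁻¹ * s)) x := by
  rw [FluidPDE.timeRescale_slice]
  exact FluidPDE.curl_const_smul_eq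
    ((hsol.contDiff_velocity (FluidPDE.mapsTo_inv_mul_Icc hν hs)).differentiable (by simp)) _

/-- Exterior enstrophy of a slice of the rescaled velocity:
`∫_{Ω}|curl v(s)|² = ν⁻² ∫_{Ω}|curl u(s/ν)|²`. [folklore] -/
theorem setLIntegral_curl_timeRescale_sq {T : ℝ} {u : ℝ → ℝ³ → ℝ³} {p : ℝ → ℝ³ → ℝ}
    (hsol : FluidPDE.IsClassicalNSSolutionOn (Icc 0 T) ν 0 u p) (hν : 0 < ν) {s : ℝ}
    (hs : s ∈ Icc 0 (ν * T)) (Ω : Set ℝ³) :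
    ∫⁻ x in Ω, ‖FluidPDE.curl (FluidPDE.timeRescale ν⁻¹ ν⁻¹ u s) x‖ₑ ^ 2 =
      ENNReal.ofReal (ν⁻¹ ^ 2) * ∫⁻ x in Ω, ‖FluidPDE.curl (u (ν⁻¹ * s)) x‖ₑ ^ 2 := by
  rw [curl_timeRescale hsol hν hs]
  exact FluidPDE.lintegral_enorm_sq_const_smul _ _ _

/-- Exterior `L²` norm of the vorticity gradient of a slice of the rescaled velocity:
`∫_{Ω}|∇ curl v(s)|² = ν⁻² ∫_{Ω}|∇ curl u(s/ν)|²`. [folklore] -/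
theorem setLIntegral_fderiv_curl_timeRescale_sq {T : ℝ} {u : ℝ → ℝ³ → ℝ³} {p : ℝ → ℝ³ → ℝ}
    (hsol : FluidPDE.IsClassicalNSSolutionOn (Icc 0 T) ν 0 u p) (hν : 0 < ν) {s : ℝ}
    (hs : s ∈ Icc 0 (ν * T)) (Ω : Set ℝ³) :
    ∫⁻ x in Ω, ‖fderiv ℝ (FluidPDE.curl (FluidPDE.timeRescale ν⁻¹ ν⁻¹ u s)) x‖ₑ ^ 2 =
      ENNReal.ofReal (ν⁻¹ ^ 2) * ∫⁻ x in Ω, ‖fderiv ℝ (FluidPDE.curl (u (ν⁻¹ * s))) x‖ₑ ^ 2 := by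
  have h2 : ContDiff ℝ 2 (u (ν⁻¹ * s)) :=
    (hsol.contDiff_velocity (FluidPDE.mapsTo_inv_mul_Icc hν hs)).of_le (by norm_cast)
  have hpt : ∀ x, fderiv ℝ (FluidPDE.curl (FluidPDE.timeRescale ν⁻¹ ν⁻¹ u s)) x =
      ν⁻¹ • fderiv ℝ (FluidPDE.curl (u (ν⁻¹ * s))) x := fun x =>
    FluidPDE.fderiv_curl_const_smul h2 ν⁻¹ x
  calc ∫⁻ x in Ω, ‖fderiv ℝ (FluidPDE.curl (FluidPDE.timeRescale ν⁻¹ ν⁻¹ u s)) x‖ₑ ^ 2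
      = ∫⁻ x in Ω, ‖ν⁻¹ • fderiv ℝ (FluidPDE.curl (u (ν⁻¹ * s))) x‖ₑ ^ 2 :=
        lintegral_congr fun x => by rw [hpt x]
    _ = ENNReal.ofReal (ν⁻¹ ^ 2) * ∫⁻ x in Ω, ‖fderiv ℝ (FluidPDE.curl (u (ν⁻¹ * s))) x‖ₑ ^ 2 :=
        FluidPDE.lintegral_enorm_sq_const_smul _ ν⁻¹ fun x => fderiv ℝ (FluidPDE.curl (u (ν⁻¹ * s))) x

/-- Dissipation density of a slice of the rescaled velocity: `|∇v(s)|² = ν⁻²|∇u(s/ν)|²`. [folklore] -/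
theorem frobeniusNormSq_fderiv_timeRescale {T : ℝ} {u : ℝ → ℝ³ → ℝ³} {p : ℝ → ℝ³ → ℝ}
    (hsol : FluidPDE.IsClassicalNSSolutionOn (Icc 0 T) ν 0 u p) (hν : 0 < ν) {s : ℝ}
    (hs : s ∈ Icc 0 (ν * T)) (x : ℝ³) :
    FluidPDE.frobeniusNormSq (fderiv ℝ (FluidPDE.timeRescale ν⁻¹ ν⁻¹ u s) x) =
      ν⁻¹ ^ 2 * FluidPDE.frobeniusNormSq (fderiv ℝ (u (ν⁻¹ * s)) x) := by
  have hd : DifferentiableAt ℝ (u (ν⁻¹ * s)) x :=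
    ((hsol.contDiff_velocity (FluidPDE.mapsTo_inv_mul_Icc hν hs)).differentiable (by simp)) x
  rw [FluidPDE.timeRescale_slice, fderiv_fun_const_smul hd, FluidPDE.frobeniusNormSq_const_smul]

/-- Space–time dissipation of the rescaled velocity:
`∫₀^{νT}∫|∇v|² = ν⁻¹ ∫₀ᵀ∫|∇u|²`. [cite: Tao2011, footnote 3] -/
theorem dissipation_timeRescale {T : ℝ} {u : ℝ → ℝ³ → ℝ³} {p : ℝ → ℝ³ → ℝ}
    (hsol : FluidPDE.IsClassicalNSSolutionOn (Icc 0 T) ν 0 u p) (hν : 0 < ν) :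
    ∫⁻ s in Ioo 0 (ν * T), ∫⁻ x,
        ENNReal.ofReal (FluidPDE.frobeniusNormSq (fderiv ℝ (FluidPDE.timeRescale ν⁻¹ ν⁻¹ u s) x)) =
      ENNReal.ofReal ν⁻¹ *
        ∫⁻ t in Ioo 0 T, ∫⁻ x, ENNReal.ofReal (FluidPDE.frobeniusNormSq (fderiv ℝ (u t) x)) := by
  have hcongr : EqOn
      (fun s => ∫⁻ x,
        ENNReal.ofReal (FluidPDE.frobeniusNormSq (fderiv ℝ (FluidPDE.timeRescale ν⁻¹ ν⁻¹ u s) x)))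
      (fun s => ENNReal.ofReal (ν⁻¹ ^ 2) *
        ∫⁻ x, ENNReal.ofReal (FluidPDE.frobeniusNormSq (fderiv ℝ (u (ν⁻¹ * s)) x)))
      (Ioo 0 (ν * T)) := by
    intro s hs
    simp only
    rw [← lintegral_const_mul' _ _ ENNReal.ofReal_ne_top]
    refine lintegral_congr fun x => ?_
    rw [frobeniusNormSq_fderiv_timeRescale hsol hν (Ioo_subset_Icc_self hs),
      ENNReal.ofReal_mul (sq_nonneg _)]
  rw [setLIntegral_congr_fun measurableSet_Ioo hcongr, lintegral_const_mul' _ _ ENNReal.ofReal_ne_top,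
    FluidPDE.setLIntegral_Ioo_comp_inv_mul
      (fun t => ∫⁻ x, ENNReal.ofReal (FluidPDE.frobeniusNormSq (fderiv ℝ (u t) x))) hν T,
    ← mul_assoc, ofReal_inv_sq_mul_ofReal hν]

/-- Space–time exterior norm of the vorticity gradient of the rescaled velocity:
`∫₀^{νT}∫_Ω|∇ curl v|² = ν⁻¹ ∫₀ᵀ∫_Ω|∇ curl u|²`. [folklore] -/
theorem setLIntegral_setLIntegral_fderiv_curl_timeRescale {T : ℝ} {u : ℝ → ℝ³ → ℝ³}
    {p : ℝ → ℝ³ → ℝ} (hsol : FluidPDE.IsClassicalNSSolutionOn (Icc 0 T) ν 0 u p) (hν : 0 < ν)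
    (Ω : Set ℝ³) :
    ∫⁻ s in Ioo 0 (ν * T), ∫⁻ x in Ω,
        ‖fderiv ℝ (FluidPDE.curl (FluidPDE.timeRescale ν⁻¹ ν⁻¹ u s)) x‖ₑ ^ 2 =
      ENNReal.ofReal ν⁻¹ *
        ∫⁻ t in Ioo 0 T, ∫⁻ x in Ω, ‖fderiv ℝ (FluidPDE.curl (u t)) x‖ₑ ^ 2 := by
  have hcongr : EqOn
      (fun s => ∫⁻ x in Ω, ‖fderiv ℝ (FluidPDE.curl (FluidPDE.timeRescale ν⁻¹ ν⁻¹ u s)) x‖ₑ ^ 2)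
      (fun s => ENNReal.ofReal (ν⁻¹ ^ 2) *
        ∫⁻ x in Ω, ‖fderiv ℝ (FluidPDE.curl (u (ν⁻¹ * s))) x‖ₑ ^ 2)
      (Ioo 0 (ν * T)) := fun s hs =>
    setLIntegral_fderiv_curl_timeRescale_sq hsol hν (Ioo_subset_Icc_self hs) Ω
  rw [setLIntegral_congr_fun measurableSet_Ioo hcongr, lintegral_const_mul' _ _ ENNReal.ofReal_ne_top,
    FluidPDE.setLIntegral_Ioo_comp_inv_mul
      (fun t => ∫⁻ x in Ω, ‖fderiv ℝ (FluidPDE.curl (u t)) x‖ₑ ^ 2) hν T,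
    ← mul_assoc, ofReal_inv_sq_mul_ofReal hν]

/-- Exterior initial enstrophy of the rescaled velocity: `‖curl v(0)‖ ≤ ν⁻¹δ` on `Ω` if
`‖curl u(0)‖ ≤ δ` there. [folklore] -/
theorem setLIntegral_curl_zero_timeRescale_le {T : ℝ} {u : ℝ → ℝ³ → ℝ³} {p : ℝ → ℝ³ → ℝ}
    (hsol : FluidPDE.IsClassicalNSSolutionOn (Icc 0 T) ν 0 u p) (hν : 0 < ν) (hT : 0 < T)
    {Ω : Set ℝ³} {δ : ℝ}
    (hω₀ : ∫⁻ x in Ω, ‖FluidPDE.curl (u 0) x‖ₑ ^ 2 ≤ ENNReal.ofReal (δ ^ 2)) :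
    ∫⁻ x in Ω, ‖FluidPDE.curl (FluidPDE.timeRescale ν⁻¹ ν⁻¹ u 0) x‖ₑ ^ 2 ≤
      ENNReal.ofReal ((ν⁻¹ * δ) ^ 2) := by
  have h0 : (0 : ℝ) ∈ Icc 0 (ν * T) := ⟨le_rfl, (mul_pos hν hT).le⟩
  rw [setLIntegral_curl_timeRescale_sq hsol hν h0, mul_zero, mul_pow,
    ENNReal.ofReal_mul (sq_nonneg _)]
  exact mul_le_mul_right hω₀ _

/-- Cancelling the factor `ν⁻²`: if `ν⁻² X ≤ ν⁻² (Aδ)²`-type bounds hold in `ℝ≥0∞` then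
`X ≤ (Aδ)²`. [folklore] -/
theorem le_of_ofReal_inv_sq_mul_le (hν : 0 < ν) {X : ℝ≥0∞} {b : ℝ}
    (h : ENNReal.ofReal (ν⁻¹ ^ 2) * X ≤ ENNReal.ofReal (ν⁻¹ ^ 2 * b)) : X ≤ ENNReal.ofReal b := by
  rw [ENNReal.ofReal_mul (sq_nonneg _)] at h
  exact (ENNReal.mul_le_mul_iff_right (ENNReal.ofReal_pos.2 (by positivity)).ne'
    ENNReal.ofReal_ne_top).1 h

/-- `√(ν⁻²E) = ν⁻¹√E` for `ν > 0`. [folklore] -/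
theorem sqrt_inv_sq_mul (hν : 0 < ν) (E : ℝ) : Real.sqrt (ν⁻¹ ^ 2 * E) = ν⁻¹ * Real.sqrt E := by
  rw [Real.sqrt_mul (sq_nonneg _), Real.sqrt_sq (inv_nonneg.2 hν.le)]

/-- `(νT)^{1/4} = ν^{1/4} T^{1/4}`. [folklore] -/
theorem mul_rpow_quarter (hν : 0 < ν) {T : ℝ} (hT : 0 ≤ T) :
    (ν * T) ^ (1 / 4 : ℝ) = ν ^ (1 / 4 : ℝ) * T ^ (1 / 4 : ℝ) :=
  Real.mul_rpow hν.le hT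

/-- `ν⁻¹ ν^{1/4} = ν^{-3/4}` for `ν > 0`. [folklore] -/
theorem inv_mul_rpow_quarter (hν : 0 < ν) : ν⁻¹ * ν ^ (1 / 4 : ℝ) = ν ^ (-(3 / 4 : ℝ)) := by
  rw [← Real.rpow_neg_one, ← Real.rpow_add hν]
  norm_num

/-- The rescaled "energy × time" quantity: `√(ν⁻²E) (νT)^{1/4} = ν^{-3/4} √E T^{1/4}`. [folklore] -/
theorem sqrt_mul_rpow_timeRescale (hν : 0 < ν) {T : ℝ} (hT : 0 ≤ T) (E : ℝ) :
    Real.sqrt (ν⁻¹ ^ 2 * E) * (ν * T) ^ (1 / 4 : ℝ) =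
      ν ^ (-(3 / 4 : ℝ)) * (Real.sqrt E * T ^ (1 / 4 : ℝ)) := by
  rw [sqrt_inv_sq_mul hν, mul_rpow_quarter hν hT, ← inv_mul_rpow_quarter hν]
  ring

/-- The smallness quantity (10.2) of the rescaled solution:
`δᵥ⁴Tᵥ + δᵥ⁵√Eᵥ Tᵥ = ν⁻³ δ⁴T + ν⁻⁵ δ⁵√E T` (`δᵥ = ν⁻¹δ`, `Tᵥ = νT`, `Eᵥ = ν⁻²E`). [folklore] -/
theorem smallness_timeRescale (hν : 0 < ν) (δ T E : ℝ) :
    (ν⁻¹ * δ) ^ 4 * (ν * T) + (ν⁻¹ * δ) ^ 5 * Real.sqrt (ν⁻¹ ^ 2 * E) * (ν * T) =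
      ν⁻¹ ^ 3 * (δ ^ 4 * T) + ν⁻¹ ^ 5 * (δ ^ 5 * Real.sqrt E * T) := by
  rw [sqrt_inv_sq_mul hν]
  have hν' : ν⁻¹ * ν = 1 := inv_mul_cancel₀ hν.ne'
  linear_combination (ν⁻¹ ^ 3 * δ ^ 4 * T + ν⁻¹ ^ 5 * δ ^ 5 * Real.sqrt E * T) * hν'

/-- Under the rescaled smallness hypothesis `δ⁴T + δ⁵√E T ≤ c/(ν⁻³ + ν⁻⁵)` the rescaled solution
obeys (10.2) with constant `c`. [folklore] -/
theorem smallness_timeRescale_le (hν : 0 < ν) {δ T E c : ℝ} (hδ : 0 < δ) (hT : 0 ≤ T)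
    (hsmall : δ ^ 4 * T + δ ^ 5 * Real.sqrt E * T ≤ c / (ν⁻¹ ^ 3 + ν⁻¹ ^ 5)) :
    (ν⁻¹ * δ) ^ 4 * (ν * T) + (ν⁻¹ * δ) ^ 5 * Real.sqrt (ν⁻¹ ^ 2 * E) * (ν * T) ≤ c := by
  rw [smallness_timeRescale hν]
  have hν' : 0 < ν⁻¹ := inv_pos.2 hν
  have hden : 0 < ν⁻¹ ^ 3 + ν⁻¹ ^ 5 := by positivity
  have hA : 0 ≤ δ ^ 4 * T := by positivity
  have hB : 0 ≤ δ ^ 5 * Real.sqrt E * T := by positivity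
  have h1 : ν⁻¹ ^ 3 * (δ ^ 4 * T) + ν⁻¹ ^ 5 * (δ ^ 5 * Real.sqrt E * T) ≤
      (ν⁻¹ ^ 3 + ν⁻¹ ^ 5) * (δ ^ 4 * T + δ ^ 5 * Real.sqrt E * T) := by
    have i3 : 0 ≤ ν⁻¹ ^ 3 := by positivity
    have i5 : 0 ≤ ν⁻¹ ^ 5 := by positivity
    nlinarith [mul_nonneg i3 hB, mul_nonneg i5 hA]
  have h2 : (ν⁻¹ ^ 3 + ν⁻¹ ^ 5) * (δ ^ 4 * T + δ ^ 5 * Real.sqrt E * T) ≤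
      (ν⁻¹ ^ 3 + ν⁻¹ ^ 5) * (c / (ν⁻¹ ^ 3 + ν⁻¹ ^ 5)) :=
    mul_le_mul_of_nonneg_left hsmall hden.le
  rw [mul_div_cancel₀ _ hden.ne'] at h2
  exact h1.trans h2

/-- Cancelling the factor `ν⁻¹`: `ν⁻¹ X ≤ ν⁻² b` gives `X ≤ ν⁻¹ b`. [folklore] -/
theorem le_of_ofReal_inv_mul_le (hν : 0 < ν) {X : ℝ≥0∞} {b : ℝ}
    (h : ENNReal.ofReal ν⁻¹ * X ≤ ENNReal.ofReal (ν⁻¹ ^ 2 * b)) :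
    X ≤ ENNReal.ofReal (ν⁻¹ * b) := by
  rw [sq, mul_assoc, ENNReal.ofReal_mul (inv_pos.2 hν).le] at h
  exact (ENNReal.mul_le_mul_iff_right (ENNReal.ofReal_pos.2 (inv_pos.2 hν)).ne'
    ENNReal.ofReal_ne_top).1 h

/-- `(Aδ)² ≤ (A(1 + ν^{-1/2})δ)²` for `A, δ ≥ 0`. [folklore] -/
theorem sq_le_sq_viscosityConst (ν : ℝ) {A δ : ℝ} (hA : 0 ≤ A) (hδ : 0 ≤ δ) :
    (A * δ) ^ 2 ≤ (A * (1 + (Real.sqrt ν)⁻¹) * δ) ^ 2 := by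
  have h0 : 0 ≤ (Real.sqrt ν)⁻¹ := inv_nonneg.2 (Real.sqrt_nonneg _)
  have h1 : A * δ ≤ A * (1 + (Real.sqrt ν)⁻¹) * δ := by
    nlinarith [mul_nonneg hA hδ, mul_nonneg (mul_nonneg hA hδ) h0]
  exact pow_le_pow_left₀ (mul_nonneg hA hδ) h1 2

/-- `ν⁻¹(Aδ)² ≤ (A(1 + ν^{-1/2})δ)²` for `ν > 0`. [folklore] -/
theorem inv_mul_sq_le_sq_viscosityConst (hν : 0 < ν) (A δ : ℝ) :
    ν⁻¹ * (A * δ) ^ 2 ≤ (A * (1 + (Real.sqrt ν)⁻¹) * δ) ^ 2 := by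
  have hs : (Real.sqrt ν)⁻¹ ^ 2 = ν⁻¹ := by rw [inv_pow, Real.sq_sqrt hν.le]
  have h0 : 0 ≤ (Real.sqrt ν)⁻¹ := inv_nonneg.2 (Real.sqrt_nonneg _)
  calc ν⁻¹ * (A * δ) ^ 2 = (Real.sqrt ν)⁻¹ ^ 2 * (A * δ) ^ 2 := by rw [hs]
    _ ≤ (1 + (Real.sqrt ν)⁻¹) ^ 2 * (A * δ) ^ 2 :=
        mul_le_mul_of_nonneg_right (pow_le_pow_left₀ h0 (by linarith) 2) (sq_nonneg _)
    _ = (A * (1 + (Real.sqrt ν)⁻¹) * δ) ^ 2 := by ring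

/-- The largeness quantity (10.3) of the rescaled solution is dominated by
`(ν⁻² + ν^{-3/4} + ν²)(E + √E T^{1/4} + δ⁻²)`. [folklore] -/
theorem largeness_timeRescale_le (hν : 0 < ν) {T E δ : ℝ} (hT : 0 ≤ T) (hE : 0 ≤ E) :
    ν⁻¹ ^ 2 * E + Real.sqrt (ν⁻¹ ^ 2 * E) * (ν * T) ^ (1 / 4 : ℝ) + (ν⁻¹ * δ)⁻¹ ^ 2 ≤
      (ν⁻¹ ^ 2 + ν ^ (-(3 / 4 : ℝ)) + ν ^ 2) * (E + Real.sqrt E * T ^ (1 / 4 : ℝ) + δ⁻¹ ^ 2) := by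
  rw [sqrt_mul_rpow_timeRescale hν hT, mul_inv, inv_inv, mul_pow]
  have ha : 0 ≤ Real.sqrt E * T ^ (1 / 4 : ℝ) := by positivity
  have hd : 0 ≤ δ⁻¹ ^ 2 := by positivity
  have hp : 0 ≤ ν⁻¹ ^ 2 := by positivity
  have hq : 0 ≤ ν ^ (-(3 / 4 : ℝ)) := (Real.rpow_pos_of_pos hν _).le
  have hs : 0 ≤ ν ^ 2 := by positivity
  nlinarith [mul_nonneg hp ha, mul_nonneg hp hd, mul_nonneg hq hE, mul_nonneg hq hd,
    mul_nonneg hs hE, mul_nonneg hs ha]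

/-- The largeness quantity of the a priori form for the rescaled solution is dominated by
`(ν⁻² + 1 + ν²)(E + M + δ⁻²)`. [folklore] -/
theorem largeness_apriori_timeRescale_le (hν : 0 < ν) {E M δ : ℝ} (hE : 0 ≤ E) (hM : 0 ≤ M) :
    ν⁻¹ ^ 2 * E + M + (ν⁻¹ * δ)⁻¹ ^ 2 ≤ (ν⁻¹ ^ 2 + 1 + ν ^ 2) * (E + M + δ⁻¹ ^ 2) := by
  rw [mul_inv, inv_inv, mul_pow]
  have hd : 0 ≤ δ⁻¹ ^ 2 := by positivity
  have hp : 0 ≤ ν⁻¹ ^ 2 := by positivity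
  have hs : 0 ≤ ν ^ 2 := by positivity
  have := hν.le
  nlinarith [mul_nonneg hp hM, mul_nonneg hp hd, mul_nonneg hs hE, mul_nonneg hs hM]

/-- `ν⁻¹ (νt) = t`, membership form: `t ∈ [0, T] ⇒ νt ∈ [0, νT]`. [folklore] -/
theorem mul_mem_Icc_mul (hν : 0 < ν) {T t : ℝ} (ht : t ∈ Icc 0 T) : ν * t ∈ Icc 0 (ν * T) :=
  ⟨mul_nonneg hν.le ht.1, mul_le_mul_of_nonneg_left ht.2 hν.le⟩

end Bookkeeping

/-! ## Rescaling `ν = 1 ⇒ ν > 0` -/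

/-- **Prop. 9.1 for every `ν > 0` from Prop. 9.1 at `ν = 1`** (Tao's footnote 3), with
`K(ν) = K(ν^{-3/4} + ν⁻²)`: apply the unit-viscosity statement to `v(s, x) = ν⁻¹u(s/ν, x)` on
`[0, νT]` (energy `ν⁻²E`) and use `∫₀^{νT}‖v‖_{L^∞} = ∫₀ᵀ‖u‖_{L^∞}`,
`√(ν⁻²E)(νT)^{1/4} = ν^{-3/4}√E T^{1/4}`. PROVED. [cite: Tao2011, Prop. 9.1 + footnote 3] -/
theorem tao2011_boundedTotalSpeed_of_unit (h : tao2011_boundedTotalSpeed_unit) :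
    tao2011_boundedTotalSpeed := by
  obtain ⟨K, hK, h⟩ := h
  intro ν hν
  have hν34 : 0 < ν ^ (-(3 / 4 : ℝ)) := Real.rpow_pos_of_pos hν _
  refine ⟨K * (ν ^ (-(3 / 4 : ℝ)) + ν⁻¹ ^ 2), by positivity, ?_⟩
  intro T hT u p hsol hfe E hE hE₀
  have key := h (mul_pos hν hT) (hsol.viscosityRescale_zero hν hT) (finiteEnergy_timeRescale hν hfe)
    (by positivity : (0 : ℝ) ≤ ν⁻¹ ^ 2 * E) (energy_zero_timeRescale_le ν hE₀)
  rw [setLIntegral_eLpNorm_timeRescale hν u T, sqrt_mul_rpow_timeRescale hν hT.le] at key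
  exact key.trans (ENNReal.ofReal_le_ofReal (by
    have ha : 0 ≤ Real.sqrt E * T ^ (1 / 4 : ℝ) := by positivity
    have i1 : 0 ≤ ν⁻¹ ^ 2 * (Real.sqrt E * T ^ (1 / 4 : ℝ)) := by positivity
    have i2 : 0 ≤ ν ^ (-(3 / 4 : ℝ)) * E := by positivity
    nlinarith))

/-- **Thm. 10.1 (exterior form) for every `ν > 0` from the printed `ν = 1` statement** (Tao's
footnote 3 / Remark 10.2), with `c(ν) = c/(ν⁻³ + ν⁻⁵)`, `C(ν) = C(ν⁻² + ν^{-3/4} + ν²)`,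
`A(ν) = A(1 + ν^{-1/2})`: apply the unit-viscosity statement to `v(s, x) = ν⁻¹u(s/ν, x)` on
`[0, νT]` with `E ↦ ν⁻²E`, `δ ↦ ν⁻¹δ` (`curl v(0) = ν⁻¹ curl u(0)`); (10.2) for `v` reads
`ν⁻³δ⁴T + ν⁻⁵δ⁵√E T ≤ c`, (10.3) for `v` is implied by `C(ν)(E + √E T^{1/4} + δ⁻²) < r`, and the
two conclusions for `v` are `ν⁻² sup_t ∫|ω|² ≤ ν⁻²(Aδ)²`, `ν⁻¹∫₀ᵀ∫|∇ω|² ≤ ν⁻²(Aδ)²`. PROVED. [cite: Tao2011, Thm. 10.1 + Remark 10.6 + footnote 3] -/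
theorem tao2011_enstrophyLocalisation_exterior_of_unit
    (h : tao2011_enstrophyLocalisation_exterior_unit) :
    tao2011_enstrophyLocalisation_exterior := by
  obtain ⟨c, C, A, hc, hC, hA, h⟩ := h
  intro ν hν
  have hν' : 0 < ν⁻¹ := inv_pos.2 hν
  have hν34 : 0 < ν ^ (-(3 / 4 : ℝ)) := Real.rpow_pos_of_pos hν _
  have hsq : 0 ≤ (Real.sqrt ν)⁻¹ := inv_nonneg.2 (Real.sqrt_nonneg _)
  refine ⟨c / (ν⁻¹ ^ 3 + ν⁻¹ ^ 5), C * (ν⁻¹ ^ 2 + ν ^ (-(3 / 4 : ℝ)) + ν ^ 2),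
    A * (1 + (Real.sqrt ν)⁻¹), by positivity, by positivity, by positivity, ?_⟩
  intro T hT u p hsol hfe E hE hE₀ x₀ R r δ hδ hr hrR hω₀ hsmall hlarge
  have hTv : 0 < ν * T := mul_pos hν hT
  have hδv : 0 < ν⁻¹ * δ := mul_pos hν' hδ
  have hEv : (0 : ℝ) ≤ ν⁻¹ ^ 2 * E := by positivity
  have hlargev : C * (ν⁻¹ ^ 2 * E + Real.sqrt (ν⁻¹ ^ 2 * E) * (ν * T) ^ (1 / 4 : ℝ) +
      (ν⁻¹ * δ)⁻¹ ^ 2) < r :=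
    calc C * (ν⁻¹ ^ 2 * E + Real.sqrt (ν⁻¹ ^ 2 * E) * (ν * T) ^ (1 / 4 : ℝ) + (ν⁻¹ * δ)⁻¹ ^ 2)
        ≤ C * ((ν⁻¹ ^ 2 + ν ^ (-(3 / 4 : ℝ)) + ν ^ 2) *
            (E + Real.sqrt E * T ^ (1 / 4 : ℝ) + δ⁻¹ ^ 2)) :=
          mul_le_mul_of_nonneg_left (largeness_timeRescale_le hν hT.le hE) hC.le
      _ = C * (ν⁻¹ ^ 2 + ν ^ (-(3 / 4 : ℝ)) + ν ^ 2) *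
            (E + Real.sqrt E * T ^ (1 / 4 : ℝ) + δ⁻¹ ^ 2) := by ring
      _ < r := hlarge
  obtain ⟨h1, h2⟩ := h hTv (hsol.viscosityRescale_zero hν hT) (finiteEnergy_timeRescale hν hfe)
    hEv (energy_zero_timeRescale_le ν hE₀) x₀ hδv hr hrR
    (setLIntegral_curl_zero_timeRescale_le hsol hν hT hω₀)
    (smallness_timeRescale_le hν hδ hT.le hsmall) hlargev
  refine ⟨fun t ht => ?_, ?_⟩
  · have hs : ν * t ∈ Icc 0 (ν * T) := mul_mem_Icc_mul hν ht
    have h1t := h1 (ν * t) hs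
    rw [setLIntegral_curl_timeRescale_sq hsol hν hs, inv_mul_cancel_left₀ hν.ne',
      show (A * (ν⁻¹ * δ)) ^ 2 = ν⁻¹ ^ 2 * (A * δ) ^ 2 by ring] at h1t
    exact (le_of_ofReal_inv_sq_mul_le hν h1t).trans
      (ENNReal.ofReal_le_ofReal (sq_le_sq_viscosityConst ν hA.le hδ.le))
  · rw [setLIntegral_setLIntegral_fderiv_curl_timeRescale hsol hν,
      show (A * (ν⁻¹ * δ)) ^ 2 = ν⁻¹ ^ 2 * (A * δ) ^ 2 by ring] at h2
    exact (le_of_ofReal_inv_mul_le hν h2).trans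
      (ENNReal.ofReal_le_ofReal (inv_mul_sq_le_sq_viscosityConst hν A δ))

/-- **The a priori form of Thm. 10.1 for every `ν > 0` from its `ν = 1` statement**, with
`c(ν) = c/(ν⁻³ + ν⁻⁵)`, `C(ν) = C(ν⁻² + 1 + ν²)`, `A(ν) = A(1 + ν^{-1/2})`: as for
`tao2011_enstrophyLocalisation_exterior_of_unit`, the additional hypotheses transforming as
`sup_s ∫|v(s)|² ≤ 2ν⁻²E`, `∫₀^{νT}∫|∇v|² = ν⁻¹∫₀ᵀ∫|∇u|² ≤ ν⁻²E` and
`∫₀^{νT}‖v‖_{L^∞} = ∫₀ᵀ‖u‖_{L^∞} ≤ M`. PROVED. [cite: Tao2011, Thm. 10.1 (proof, §10) + Remark 10.6 + footnote 3] -/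
theorem tao2011_enstrophyLocalisation_exterior_apriori_of_unit
    (h : tao2011_enstrophyLocalisation_exterior_apriori_unit) :
    tao2011_enstrophyLocalisation_exterior_apriori := by
  obtain ⟨c, C, A, hc, hC, hA, h⟩ := h
  intro ν hν
  have hν' : 0 < ν⁻¹ := inv_pos.2 hν
  have hsq : 0 ≤ (Real.sqrt ν)⁻¹ := inv_nonneg.2 (Real.sqrt_nonneg _)
  refine ⟨c / (ν⁻¹ ^ 3 + ν⁻¹ ^ 5), C * (ν⁻¹ ^ 2 + 1 + ν ^ 2), A * (1 + (Real.sqrt ν)⁻¹),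
    by positivity, by positivity, by positivity, ?_⟩
  intro T hT u p hsol E M hE hM hEt hD hMt x₀ R r δ hδ hr hrR hω₀ hsmall hlarge
  have hTv : 0 < ν * T := mul_pos hν hT
  have hδv : 0 < ν⁻¹ * δ := mul_pos hν' hδ
  have hEv : (0 : ℝ) ≤ ν⁻¹ ^ 2 * E := by positivity
  have hDv : ENNReal.ofReal 1 * ∫⁻ s in Ioo 0 (ν * T), ∫⁻ x, ENNReal.ofReal
      (FluidPDE.frobeniusNormSq (fderiv ℝ (FluidPDE.timeRescale ν⁻¹ ν⁻¹ u s) x)) ≤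
      ENNReal.ofReal (ν⁻¹ ^ 2 * E) := by
    rw [ENNReal.ofReal_one, one_mul, dissipation_timeRescale hsol hν, ← ofReal_inv_sq_mul_ofReal hν,
      mul_assoc, ENNReal.ofReal_mul (sq_nonneg _)]
    exact mul_le_mul_right hD _
  have hMtv : ∫⁻ s in Ioo 0 (ν * T), eLpNorm (FluidPDE.timeRescale ν⁻¹ ν⁻¹ u s) ∞ volume ≤
      ENNReal.ofReal M := by
    rw [setLIntegral_eLpNorm_timeRescale hν u T]
    exact hMt
  have hlargev : C * (ν⁻¹ ^ 2 * E + M + (ν⁻¹ * δ)⁻¹ ^ 2) < r :=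
    calc C * (ν⁻¹ ^ 2 * E + M + (ν⁻¹ * δ)⁻¹ ^ 2)
        ≤ C * ((ν⁻¹ ^ 2 + 1 + ν ^ 2) * (E + M + δ⁻¹ ^ 2)) :=
          mul_le_mul_of_nonneg_left (largeness_apriori_timeRescale_le hν hE hM) hC.le
      _ = C * (ν⁻¹ ^ 2 + 1 + ν ^ 2) * (E + M + δ⁻¹ ^ 2) := by ring
      _ < r := hlarge
  obtain ⟨h1, h2⟩ := h hTv (hsol.viscosityRescale_zero hν hT) hEv hM
    (energy_timeRescale_le hν hEt) hDv hMtv x₀ hδv hr hrR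
    (setLIntegral_curl_zero_timeRescale_le hsol hν hT hω₀)
    (smallness_timeRescale_le hν hδ hT.le hsmall) hlargev
  refine ⟨fun t ht => ?_, ?_⟩
  · have hs : ν * t ∈ Icc 0 (ν * T) := mul_mem_Icc_mul hν ht
    have h1t := h1 (ν * t) hs
    rw [setLIntegral_curl_timeRescale_sq hsol hν hs, inv_mul_cancel_left₀ hν.ne',
      show (A * (ν⁻¹ * δ)) ^ 2 = ν⁻¹ ^ 2 * (A * δ) ^ 2 by ring] at h1t
    exact (le_of_ofReal_inv_sq_mul_le hν h1t).trans
      (ENNReal.ofReal_le_ofReal (sq_le_sq_viscosityConst ν hA.le hδ.le))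
  · rw [setLIntegral_setLIntegral_fderiv_curl_timeRescale hsol hν,
      show (A * (ν⁻¹ * δ)) ^ 2 = ν⁻¹ ^ 2 * (A * δ) ^ 2 by ring] at h2
    exact (le_of_ofReal_inv_mul_le hν h2).trans
      (ENNReal.ofReal_le_ofReal (inv_mul_sq_le_sq_viscosityConst hν A δ))

/-! ## The equivalences and the unit-viscosity leaf structure -/

/-- **Prop. 9.1: the tree's `ν > 0` form is equivalent to the printed `ν = 1` form.** PROVED. [cite: Tao2011, Prop. 9.1 + footnote 3] -/
theorem tao2011_boundedTotalSpeed_iff_unit :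
    tao2011_boundedTotalSpeed ↔ tao2011_boundedTotalSpeed_unit :=
  ⟨tao2011_boundedTotalSpeed_unit_of, tao2011_boundedTotalSpeed_of_unit⟩

/-- **Thm. 10.1 (exterior form): the tree's `ν > 0` form is equivalent to the printed `ν = 1`
form.** PROVED. [cite: Tao2011, Thm. 10.1 + Remark 10.6 + footnote 3] -/
theorem tao2011_enstrophyLocalisation_exterior_iff_unit :
    tao2011_enstrophyLocalisation_exterior ↔ tao2011_enstrophyLocalisation_exterior_unit :=
  ⟨tao2011_enstrophyLocalisation_exterior_unit_of, tao2011_enstrophyLocalisation_exterior_of_unit⟩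

/-- **Thm. 10.1, a priori form: the `ν > 0` form is equivalent to the `ν = 1` form.** PROVED. [cite: Tao2011, Thm. 10.1 (proof, §10) + Remark 10.6 + footnote 3] -/
theorem tao2011_enstrophyLocalisation_exterior_apriori_iff_unit :
    tao2011_enstrophyLocalisation_exterior_apriori ↔
      tao2011_enstrophyLocalisation_exterior_apriori_unit :=
  ⟨tao2011_enstrophyLocalisation_exterior_apriori_unit_of,
    tao2011_enstrophyLocalisation_exterior_apriori_of_unit⟩

/-- The unit-viscosity a priori form asserts nothing beyond the printed Thm. 10.1 at `ν = 1`: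
it follows from `tao2011_enstrophyLocalisation_exterior_unit` (via the `ν > 0` forms and
`tao2011_enstrophyLocalisation_exterior_apriori_of_exterior`). PROVED. [cite: Tao2011, Thm. 10.1 + Remark 10.6] -/
theorem tao2011_enstrophyLocalisation_exterior_apriori_unit_of_exterior_unit
    (h : tao2011_enstrophyLocalisation_exterior_unit) :
    tao2011_enstrophyLocalisation_exterior_apriori_unit :=
  tao2011_enstrophyLocalisation_exterior_apriori_unit_of
    (tao2011_enstrophyLocalisation_exterior_apriori_of_exterior
      (tao2011_enstrophyLocalisation_exterior_of_unit h))

/-- **Cor. 11.1 (bounded enstrophy, every `ν > 0`) from its printed unit-viscosity leaves**: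
Lemma 8.1 (`tao_finite_energy_smooth_energy_bound`), Prop. 9.1 at `ν = 1` and the §10 argument
at `ν = 1`; the Fourier step is proved (`tao2011_sobolev_of_vorticity_holds`) and the passage to
`ν > 0` is the rescaling proved above. [cite: Tao2011, Cor. 11.1] -/
theorem tao2011_boundedEnstrophy_of_unit_leaves (hL : tao_finite_energy_smooth_energy_bound)
    (hP : tao2011_boundedTotalSpeed_unit)
    (hA' : tao2011_enstrophyLocalisation_exterior_apriori_unit) : tao2011_boundedEnstrophy :=
  tao2011_boundedEnstrophy_of_leaves hL (tao2011_boundedTotalSpeed_of_unit hP)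
    (tao2011_enstrophyLocalisation_exterior_apriori_of_unit hA')

/-- **Cor. 11.4 from its printed unit-viscosity leaves**: Lemma 8.1, Prop. 9.1 (`ν = 1`) and the
§10 argument (`ν = 1`) give Cor. 11.4 as printed (`tao_unconditional_uniqueness`), its velocity
form and the duplicate vendoring `tao_finite_energy_velocity_uniqueness`, for every viscosity
`ν > 0`; the `B`-side of Remark 11.3 (Cor. 4.3 + Thm. 5.4 (iii)) is not a hypothesis: it is the
tree theorem `tao2011_velocity_eq_of_memSobolevX_holds` (`NSVelocityUniqueness.lean`), fed in
here (cf. `tao_unconditional_uniqueness_of_leaves'`, `NSUnconditionalUniquenessLeaves.lean`, the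
same assembly at `ν > 0`). [cite: Tao2011, Cor. 11.4 (Remark 11.3) + footnote 3] -/
theorem tao_unconditional_uniqueness_of_unit_leaves (hL : tao_finite_energy_smooth_energy_bound)
    (hP : tao2011_boundedTotalSpeed_unit)
    (hA' : tao2011_enstrophyLocalisation_exterior_apriori_unit) :
    tao_unconditional_uniqueness ∧ tao_unconditional_uniqueness_velocity ∧
      tao_finite_energy_velocity_uniqueness :=
  tao_unconditional_uniqueness_of_leaves hL (tao2011_boundedTotalSpeed_of_unit hP)
    (tao2011_enstrophyLocalisation_exterior_apriori_of_unit hA')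
    tao2011_velocity_eq_of_memSobolevX_holds

/-! ## Cor. 11.1 and Cor. 11.4 (velocity form) themselves at unit viscosity

The remaining nodes of the `A`-side are also printed for `ν = 1`; for completeness we record their
unit-viscosity forms and **prove** the passage to `ν > 0` (so that every `ν > 0` statement in the
Cor. 11.4 chain is now a proved consequence of `ν = 1` statements). The `B`-side composite
Cor. 4.3 + Thm. 5.4 (iii) is proved outright in the tree (`tao2011_velocity_eq_of_memSobolevX_holds`)
and gets no unit form. -/

section SobolevBookkeeping

variable {ν : ℝ}

/-- The rescaling is undone by the inverse rescaling: `ν • (ν⁻¹ • u((ν⁻¹(νs)))) = u(s)`. [folklore] -/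
theorem timeRescale_timeRescale_cancel (hν : ν ≠ 0) (u : ℝ → ℝ³ → ℝ³) :
    FluidPDE.timeRescale ν ν (FluidPDE.timeRescale ν⁻¹ ν⁻¹ u) = u := by
  funext s x
  simp only [FluidPDE.timeRescale_apply, smul_smul, mul_inv_cancel₀ hν, one_smul,
    inv_mul_cancel_left₀ hν]

/-- Slices of the rescaled field are smooth when those of the field are. [folklore] -/
theorem contDiff_timeRescale_slice (hν : 0 < ν) {T : ℝ} {u : ℝ → ℝ³ → ℝ³}
    (hsm : ∀ t ∈ Icc 0 T, ContDiff ℝ ∞ (u t)) :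
    ∀ s ∈ Icc 0 (ν * T), ContDiff ℝ ∞ (FluidPDE.timeRescale ν⁻¹ ν⁻¹ u s) := fun s hs => by
  rw [FluidPDE.timeRescale_slice]
  exact (hsm _ (FluidPDE.mapsTo_inv_mul_Icc hν hs)).const_smul _

/-- Sobolev seminorms of the slices of the rescaled field: `∫‖Dʲv(s)‖² = ν⁻² ∫‖Dʲu(s/ν)‖²`
(smooth slices). [folklore] -/
theorem lintegral_iteratedFDeriv_timeRescale_sq (hν : 0 < ν) {T : ℝ} {u : ℝ → ℝ³ → ℝ³}
    (hsm : ∀ t ∈ Icc 0 T, ContDiff ℝ ∞ (u t)) {s : ℝ} (hs : s ∈ Icc 0 (ν * T)) (j : ℕ) :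
    ∫⁻ x, ‖iteratedFDeriv ℝ j (FluidPDE.timeRescale ν⁻¹ ν⁻¹ u s) x‖ₑ ^ 2 =
      ENNReal.ofReal (ν⁻¹ ^ 2) * ∫⁻ x, ‖iteratedFDeriv ℝ j (u (ν⁻¹ * s)) x‖ₑ ^ 2 := by
  have hj : ContDiff ℝ j (u (ν⁻¹ * s)) :=
    (hsm _ (FluidPDE.mapsTo_inv_mul_Icc hν hs)).of_le (mod_cast le_top)
  have hpt : ∀ x, iteratedFDeriv ℝ j (FluidPDE.timeRescale ν⁻¹ ν⁻¹ u s) x =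
      ν⁻¹ • iteratedFDeriv ℝ j (u (ν⁻¹ * s)) x := fun x => by
    rw [FluidPDE.timeRescale_slice]
    exact iteratedFDeriv_const_smul_apply' hj.contDiffAt
  calc ∫⁻ x, ‖iteratedFDeriv ℝ j (FluidPDE.timeRescale ν⁻¹ ν⁻¹ u s) x‖ₑ ^ 2
      = ∫⁻ x, ‖ν⁻¹ • iteratedFDeriv ℝ j (u (ν⁻¹ * s)) x‖ₑ ^ 2 :=
        lintegral_congr fun x => by rw [hpt x]
    _ = ENNReal.ofReal (ν⁻¹ ^ 2) * ∫⁻ x, ‖iteratedFDeriv ℝ j (u (ν⁻¹ * s)) x‖ₑ ^ 2 :=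
        FluidPDE.lintegral_enorm_sq_const_smul _ ν⁻¹ fun x => iteratedFDeriv ℝ j (u (ν⁻¹ * s)) x

/-- **`X^k` is preserved by the rescaling**: `u ∈ X^k([0,T] × ℝ³)` gives
`v ∈ X^k([0, νT] × ℝ³)` (sup bounds scale by `ν⁻²`, the `L²_t` integral by `ν⁻¹`). [cite: Tao2011, footnote 3] -/
theorem memSobolevX_timeRescale (hν : 0 < ν) {T : ℝ} {u : ℝ → ℝ³ → ℝ³}
    (hsm : ∀ t ∈ Icc 0 T, ContDiff ℝ ∞ (u t)) {k : ℕ} (hX : MemSobolevX k T u) :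
    MemSobolevX k (ν * T) (FluidPDE.timeRescale ν⁻¹ ν⁻¹ u) := by
  refine ⟨fun j hj => ?_, ?_⟩
  · obtain ⟨C, hC⟩ := hX.1 j hj
    refine ⟨Real.toNNReal (ν⁻¹ ^ 2) * C, fun s hs => ?_⟩
    rw [lintegral_iteratedFDeriv_timeRescale_sq hν hsm hs j, ENNReal.coe_mul]
    exact mul_le_mul_right (hC _ (FluidPDE.mapsTo_inv_mul_Icc hν hs)) _
  · have hcongr : EqOn
        (fun s => ∫⁻ x, ‖iteratedFDeriv ℝ (k + 1) (FluidPDE.timeRescale ν⁻¹ ν⁻¹ u s) x‖ₑ ^ 2)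
        (fun s => ENNReal.ofReal (ν⁻¹ ^ 2) *
          ∫⁻ x, ‖iteratedFDeriv ℝ (k + 1) (u (ν⁻¹ * s)) x‖ₑ ^ 2) (Ioo 0 (ν * T)) :=
      fun s hs => lintegral_iteratedFDeriv_timeRescale_sq hν hsm (Ioo_subset_Icc_self hs) (k + 1)
    rw [setLIntegral_congr_fun measurableSet_Ioo hcongr,
      lintegral_const_mul' _ _ ENNReal.ofReal_ne_top,
      FluidPDE.setLIntegral_Ioo_comp_inv_mul
        (fun t => ∫⁻ x, ‖iteratedFDeriv ℝ (k + 1) (u t) x‖ₑ ^ 2) hν T,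
      ← mul_assoc, ofReal_inv_sq_mul_ofReal hν]
    exact ENNReal.mul_lt_top ENNReal.ofReal_lt_top hX.2

/-- Conversely, `v ∈ X^k([0, νT] × ℝ³)` gives `u ∈ X^k([0, T] × ℝ³)` (apply the previous lemma
to `v` with `ν⁻¹` in place of `ν`). [cite: Tao2011, footnote 3] -/
theorem memSobolevX_of_timeRescale (hν : 0 < ν) {T : ℝ} {u : ℝ → ℝ³ → ℝ³}
    (hsm : ∀ t ∈ Icc 0 T, ContDiff ℝ ∞ (u t)) {k : ℕ}
    (hX : MemSobolevX k (ν * T) (FluidPDE.timeRescale ν⁻¹ ν⁻¹ u)) : MemSobolevX k T u := by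
  have h := memSobolevX_timeRescale (inv_pos.2 hν) (contDiff_timeRescale_slice hν hsm) hX
  rwa [inv_inv, timeRescale_timeRescale_cancel hν.ne', inv_mul_cancel_left₀ hν.ne'] at h

/-- The rescaled velocities agree at time `νt` iff the velocities agree at time `t`. [folklore] -/
theorem eq_of_timeRescale_eq (hν : 0 < ν) {u v : ℝ → ℝ³ → ℝ³} {t : ℝ}
    (h : FluidPDE.timeRescale ν⁻¹ ν⁻¹ u (ν * t) = FluidPDE.timeRescale ν⁻¹ ν⁻¹ v (ν * t)) :
    u t = v t := by
  funext x
  have hx := congrFun h x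
  simp only [FluidPDE.timeRescale_apply, inv_mul_cancel_left₀ hν.ne'] at hx
  exact smul_right_injective _ (inv_ne_zero hν.ne') hx

end SobolevBookkeeping

/-- **Tao 2011, Cor. 11.1 (Bounded enstrophy), unit viscosity** (arXiv Cor. 68, p. 36), `f = 0`:
a finite energy classical solution on the closed slab `[0, T] × ℝ³` of the `ν = 1` system whose
datum has finite `H¹` norm lies in `X¹([0, T] × ℝ³)`; dictionary as in the tree's `ν > 0` form
`tao2011_boundedEnstrophy`, to which it is equivalent (`tao2011_boundedEnstrophy_iff_unit`). [cite: Tao2011, Cor. 11.1] -/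
def tao2011_boundedEnstrophy_unit : Prop :=
  ∀ ⦃T : ℝ⦄ (_hT : 0 < T) ⦃u : ℝ → ℝ³ → ℝ³⦄ ⦃p : ℝ → ℝ³ → ℝ⦄
    (_hsol : FluidPDE.IsClassicalNSSolutionOn (Icc 0 T) 1 0 u p)
    (_hE : ∃ C : ℝ≥0, ∀ t ∈ Icc 0 T, ∫⁻ x, ‖u t x‖ₑ ^ 2 ≤ C)
    (_h₀ : ∫⁻ x, ‖iteratedFDeriv ℝ 1 (u 0) x‖ₑ ^ 2 < ⊤),
    MemSobolevX 1 T u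

/-- Cor. 11.1 for every `ν > 0` from Cor. 11.1 at `ν = 1` (rescaling; `X¹` is preserved and
`∫‖D¹v(0)‖² = ν⁻²∫‖D¹u(0)‖²`). PROVED. [cite: Tao2011, Cor. 11.1 + footnote 3] -/
theorem tao2011_boundedEnstrophy_of_unit (h : tao2011_boundedEnstrophy_unit) :
    tao2011_boundedEnstrophy := by
  intro ν T hν hT u p hsol hfe h₀
  have hsm : ∀ t ∈ Icc 0 T, ContDiff ℝ ∞ (u t) := fun t ht => hsol.contDiff_velocity ht
  have h₀v : ∫⁻ x, ‖iteratedFDeriv ℝ 1 (FluidPDE.timeRescale ν⁻¹ ν⁻¹ u 0) x‖ₑ ^ 2 < ⊤ := by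
    rw [lintegral_iteratedFDeriv_timeRescale_sq hν hsm ⟨le_rfl, (mul_pos hν hT).le⟩ 1, mul_zero]
    exact ENNReal.mul_lt_top ENNReal.ofReal_lt_top h₀
  exact memSobolevX_of_timeRescale hν hsm
    (h (mul_pos hν hT) (hsol.viscosityRescale_zero hν hT) (finiteEnergy_timeRescale hν hfe) h₀v)

/-- Cor. 11.1: the `ν > 0` and `ν = 1` forms are equivalent. PROVED. [cite: Tao2011, Cor. 11.1 + footnote 3] -/
theorem tao2011_boundedEnstrophy_iff_unit : tao2011_boundedEnstrophy ↔ tao2011_boundedEnstrophy_unit :=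
  ⟨fun h _T hT _u _p hsol hE h₀ => h one_pos hT hsol hE h₀, tao2011_boundedEnstrophy_of_unit⟩

/-- **Tao 2011, Cor. 11.4 (Unconditional uniqueness), velocity form, unit viscosity** — the
`ν = 1` instance of the tree's velocity rendering `tao_unconditional_uniqueness_velocity`
(`f = 0`, classical solutions on the closed slab, *both pressures free*, conclusion `u = v`), to
which it is equivalent (`tao_unconditional_uniqueness_velocity_iff_unit`). This is *stronger than
the printed* Cor. 11.4 (arXiv Cor. 71, p. 36: "Let `(u₀, f, T)` be smooth `H¹` data. Then there is
at most one almost smooth finite energy solution `(u, p, u₀, f, T)` with this data and with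
normalised pressure"), which requires normalised pressure; the pressure-free velocity conclusion
is justified in the tree via Remark 11.3 (see `tao_unconditional_uniqueness_velocity`). The printed
statement at `ν = 1` is the `ν := 1` instance of `tao_unconditional_uniqueness`. [cite: Tao2011, Cor. 11.4 + Remark 11.3] -/
def tao_unconditional_uniqueness_velocity_unit : Prop :=
  ∀ (T : ℝ), 0 < T →
    ∀ (u₀ : ℝ³ → ℝ³), MemLp u₀ 2 volume → MemLp (fderiv ℝ u₀) 2 volume →
    ∀ (u v : ℝ → ℝ³ → ℝ³) (p q : ℝ → ℝ³ → ℝ),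
      FluidPDE.IsClassicalNSSolutionOn (Icc 0 T) 1 0 u p →
      FluidPDE.IsClassicalNSSolutionOn (Icc 0 T) 1 0 v q →
      u 0 = u₀ → v 0 = u₀ →
      (∃ C : ℝ≥0∞, C < ⊤ ∧ ∀ t ∈ Icc 0 T, ∫⁻ x, ‖u t x‖ₑ ^ 2 ≤ C) →
      (∃ C : ℝ≥0∞, C < ⊤ ∧ ∀ t ∈ Icc 0 T, ∫⁻ x, ‖v t x‖ₑ ^ 2 ≤ C) →
      ∀ t ∈ Icc 0 T, u t = v t

/-- An `ℝ≥0∞` energy bound `C < ⊤` on `[0, T]` rescales to the bound `ν⁻²C < ⊤` on `[0, νT]`. [folklore] -/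
theorem finiteEnergy_top_timeRescale {ν : ℝ} (hν : 0 < ν) {T : ℝ} {w : ℝ → ℝ³ → ℝ³}
    (h : ∃ C : ℝ≥0∞, C < ⊤ ∧ ∀ t ∈ Icc 0 T, ∫⁻ x, ‖w t x‖ₑ ^ 2 ≤ C) :
    ∃ C : ℝ≥0∞, C < ⊤ ∧ ∀ s ∈ Icc 0 (ν * T), ∫⁻ x, ‖FluidPDE.timeRescale ν⁻¹ ν⁻¹ w s x‖ₑ ^ 2 ≤ C := by
  obtain ⟨C, hC, hb⟩ := h
  refine ⟨ENNReal.ofReal (ν⁻¹ ^ 2) * C, ENNReal.mul_lt_top ENNReal.ofReal_lt_top hC,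
    fun s hs => ?_⟩
  rw [lintegral_timeRescale_sq]
  exact mul_le_mul_right (hb _ (FluidPDE.mapsTo_inv_mul_Icc hν hs)) _

/-- **Cor. 11.4 (velocity form) for every `ν > 0` from its `ν = 1` instance**: rescale
both solutions to unit viscosity on `[0, νT]` (datum `ν⁻¹u₀ ∈ H¹`, finite energy preserved) and
read off `u(t) = v(t)` from `ν⁻¹u(t) = ν⁻¹v(t)`. PROVED. [cite: Tao2011, Cor. 11.4 + footnote 3] -/
theorem tao_unconditional_uniqueness_velocity_of_unit
    (h : tao_unconditional_uniqueness_velocity_unit) : tao_unconditional_uniqueness_velocity := by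
  intro ν T hν hT u₀ h₀ h₁ u v p q hu hv hu0 hv0 hEu hEv t ht
  have hd : Differentiable ℝ u₀ := hu0 ▸ (hu.contDiff_velocity ⟨le_rfl, hT.le⟩).differentiable (by simp)
  have h₀' : MemLp (fun x => ν⁻¹ • u₀ x) 2 volume := h₀.const_smul ν⁻¹
  have hfd : fderiv ℝ (fun x => ν⁻¹ • u₀ x) = fun x => ν⁻¹ • fderiv ℝ u₀ x :=
    funext fun x => fderiv_fun_const_smul (hd x) ν⁻¹
  have h₁' : MemLp (fderiv ℝ fun x => ν⁻¹ • u₀ x) 2 volume := by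
    rw [hfd]
    exact h₁.const_smul ν⁻¹
  have hu0' : FluidPDE.timeRescale ν⁻¹ ν⁻¹ u 0 = fun x => ν⁻¹ • u₀ x := by
    rw [FluidPDE.timeRescale_zero, hu0]
  have hv0' : FluidPDE.timeRescale ν⁻¹ ν⁻¹ v 0 = fun x => ν⁻¹ • u₀ x := by
    rw [FluidPDE.timeRescale_zero, hv0]
  exact eq_of_timeRescale_eq hν
    (h (ν * T) (mul_pos hν hT) _ h₀' h₁' _ _ _ _ (hu.viscosityRescale_zero hν hT)
      (hv.viscosityRescale_zero hν hT) hu0' hv0' (finiteEnergy_top_timeRescale hν hEu)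
      (finiteEnergy_top_timeRescale hν hEv) (ν * t) (mul_mem_Icc_mul hν ht))

/-- Cor. 11.4 (velocity form): the `ν > 0` and `ν = 1` forms are equivalent. PROVED. [cite: Tao2011, Cor. 11.4 + footnote 3] -/
theorem tao_unconditional_uniqueness_velocity_iff_unit :
    tao_unconditional_uniqueness_velocity ↔ tao_unconditional_uniqueness_velocity_unit :=
  ⟨fun h T hT u₀ h₀ h₁ u v p q hu hv hu0 hv0 hEu hEv =>
      h 1 T one_pos hT u₀ h₀ h₁ u v p q hu hv hu0 hv0 hEu hEv,
    tao_unconditional_uniqueness_velocity_of_unit⟩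

/-- **Cor. 11.4 as vendored (`tao_unconditional_uniqueness`, every `ν > 0`, normalised
pressures) follows from the `ν = 1` velocity statement.** PROVED. [cite: Tao2011, Cor. 11.4 + Remark 11.3 + footnote 3] -/
theorem tao_unconditional_uniqueness_of_velocity_unit
    (h : tao_unconditional_uniqueness_velocity_unit) : tao_unconditional_uniqueness :=
  tao_unconditional_uniqueness.of_velocity (tao_unconditional_uniqueness_velocity_of_unit h)

end Literature.Analysis.FluidPDE


end
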